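import Literature.AlgebraicTopology.SingularHomology.RelativeHomotopyAdditionCone
import Literature.AlgebraicTopology.SingularHomology.RelativeEilenbergRetractionOne
import Literature.AlgebraicTopology.SingularHomology.RelativeHurewiczPiTwoProofs
import HarnessLib

/-!
# Proof of `relativeHurewicz_subsingleton` (Miller Cor. 65.5, vanishing form) via cone classes

Topic `Literature/AlgebraicTopology/SingularHomology`, third sibling proof file of
`RelativeHurewicz.lean`, which vendors H. Miller, *Lectures on Algebraic Topology* (2020), Cor. 65.5,
first clause, as the named fact `relativeHurewicz_subsingleton`: for `A ⊆ X` both simply connected,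
`n ≥ 2`, `Hᵢ(X, A; ℤ) = 0` for `2 ≤ i < n` ⟹ `π_k(X, A, a) = 0` for `1 ≤ k < n`. This file
DISCHARGES it:

* `relativeHurewicz_subsingleton_holds : relativeHurewicz_subsingleton`.

The route is Miller's induction (proof of Cor. 65.5, p. 220) over E. H. Spanier's chain-level
argument (d) of the proof of Thm. 7.5.4 (*Algebraic Topology* (1981), Ch. 7 §5, p. 397), exactly as
in `RelativeHurewiczProofs.lean`, but with the device of relative classes for which the homotopy
addition theorem `Bₙ` is PROVED in the tree — the **cone classes** `coneClass α` of
`RelativeHomotopyAdditionCone.lean` (`sum_neg_one_pow_smul_coneClass_eq_zero`, valid for simplices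
with codimension-two skeleton in `A`, vertices at `a` and the edge `[v₀, v₁]` at `a`) — and the
relative Eilenberg retractions with normalised `1`-skeleta of `RelativeEilenbergRetractionOne.lean`
(`exists_relEilenbergRetraction₁`, Spanier Thm. 7.4.8 for `X`, `A` simply connected), whose simplices
satisfy that edge condition:

* `degenOne_eq_map` — the degeneracy of `RelativeHomotopyAdditionCone.lean` is Mathlib's
  `stdSimplex.map (Fin.predAbove 1)` (the claim of its docstring, proved here);
* `exists_coneClass_eq` — every element of `π_{k+3}(X, A, a)` is the cone class of a map
  `α : (Δᵏ⁺³, ∂Δᵏ⁺³) → (X, A)` sending the whole `1`-skeleton to `a` (a representative is constant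
  on the fibres of the cone chart, a quotient map, hence descends: Spanier p. 393, "any element of
  `πₙ(X, A, x₀)` can be represented by such a map `α`");
* `ConeProof.psi` — Spanier's homomorphism `ψ : Δ_{k+3}(X) → π_{k+3}(X, A, a)`, `σ ↦ [σ]` (cone
  class) on maps of triples and `0` otherwise; `ψ ∘ ∂ = 0` on simplices with `(k+2)`-skeleton in `A`
  and `1`-skeleton at `a` (`psi_bd_single_eq_zero`, from the homotopy addition theorem) and `ψ = 0`
  on chains of `A` (compression);
* `coneClass_eq_one_of_bd_sub_mem`, `coneClass_eq_one_of_isZero` — the core of (d): a class whose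
  elementary chain is a relative boundary is trivial (apply `ρ♯`, then `ψ`); with
  `H_{k+3}(X, A; ℤ) = 0` every class is;
* `subsingleton_relHomotopyGroup_of_retraction₁` — `π_{k+3}(X, A, a) = 0` given a retraction of
  level `k + 2` and `H_{k+3}(X, A; ℤ) = 0`;
* `relativeHurewicz_subsingleton_holds` — Miller's induction: `k = 1` by exactness
  (`subsingleton_relHomotopyGroup_one_of_simplyConnectedSpace`), `k = 2` by the degree-two step
  `relativeHurewicz_pi_two_holds` (`RelativeHurewiczPiTwoProofs.lean`), `k ≥ 3` by the above, the
  induction hypothesis making `(X, A)` `(k-1)`-connected so that the retraction exists.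

Everything is proved; the named fact `relHomotopyAddition` (the theorem `Bₙ` for the other device
`relSimplexClass`) is not used.

## References

* H. Miller, *Lectures on Algebraic Topology*, World Scientific (2020/2022), Lecture 65, Thm. 65.4,
  Cor. 65.5 and its proof (held copy PDF pp. 219–220). [Miller2020]
* E. H. Spanier, *Algebraic Topology*, Springer (1981), Ch. 7 §4 Thm. 8, §5 Prop. 3 and part (d) of
  the proof of Thm. 7.5.4 (p. 397). [Spanier1981]
* A. Hatcher, *Algebraic Topology*, CUP (2002), §4.2, Thm. 4.32. [HatcherAT2002]
-/

noncomputable section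

-- see the implementation notes of `SingularChainsConcrete.lean` (chains are `Finsupp`s up to unfolding)
set_option backward.isDefEq.respectTransparency false

open CategoryTheory Limits Set Function
open scoped unitInterval Topology
open Literature.AlgebraicTopology.Homotopy Literature.AlgebraicTopology.Homotopy.LiddedCube

universe u

namespace Literature.AlgebraicTopology.SingularHomology

open CubeCollapse

variable {X : Type u} [TopologicalSpace X]

/-! ### The cone chart is a quotient map whose non-trivial fibres lie in `J` -/

section ConeChart

variable {n : ℕ}

/-- `flipZero` is an involution. [folklore] -/
lemma flipZero_flipZero (z : Fin (n + 1) → I) : flipZero (flipZero z) = z := by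
  unfold flipZero
  rw [Fin.cons_zero, Fin.tail_cons, unitInterval.symm_symm, Fin.cons_self_tail]

/-- `flipZero` as a self-homeomorphism of the cube. [folklore] -/
def flipHomeo (n : ℕ) : (Fin (n + 1) → I) ≃ₜ (Fin (n + 1) → I) where
  toFun := flipZero
  invFun := flipZero
  left_inv := flipZero_flipZero
  right_inv := flipZero_flipZero
  continuous_toFun := continuous_flipZero
  continuous_invFun := continuous_flipZero

/-- **The cone chart is a quotient map** (the collapse is, `CubeCollapse.isQuotientMap_collapse`).
[folklore] -/
lemma isQuotientMap_coneChart : Topology.IsQuotientMap (coneChart n) :=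
  isQuotientMap_collapse.comp (flipHomeo n).isQuotientMap

/-- The cone chart is onto. [folklore] -/
lemma coneChart_surjective : Function.Surjective (coneChart n) :=
  isQuotientMap_coneChart.surjective

/-- A point off `∂Iⁿ⁺¹` stays off `∂Iⁿ⁺¹` under `flipZero`. [folklore] -/
lemma flipZero_not_mem_boundary {z : Fin (n + 1) → I} (hz : z ∉ Cube.boundary (Fin (n + 1))) :
    flipZero z ∉ Cube.boundary (Fin (n + 1)) := fun h => by
  have := flipZero_mem_boundary h
  rw [flipZero_flipZero] at this
  exact hz this

/-- The cone chart maps the open cube off `∂Δⁿ⁺¹`. [folklore] -/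
lemma coneChart_not_mem_stdBoundary {z : Fin (n + 1) → I} (hz : z ∉ Cube.boundary (Fin (n + 1))) :
    coneChart n z ∉ stdBoundary (n + 1) :=
  collapse_not_mem_stdBoundary (flipZero_not_mem_boundary hz)

/-- **Two distinct points with the same image under the cone chart lie in `J = {z₀ = 1} ∪ walls`**:
the first coordinate is preserved, and off the lid the collapse of the remaining coordinates is
injective off `∂Iⁿ`. [folklore] -/
lemma mem_jBoundary_of_coneChart_eq {z z' : Fin (n + 1) → I} (h : coneChart n z = coneChart n z')
    (hne : z ≠ z') : z ∈ RelGenLoop.jBoundary (0 : Fin (n + 1)) := by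
  have hc := congrArg (fun w : StdSimplex (n + 1) => (w : Fin (n + 2) → ℝ)) h
  simp only [coe_coneChart] at hc
  have h0 : z 0 = z' 0 := Subtype.ext (by simpa using congrFun hc 0)
  by_cases hz0 : z 0 = 1
  · exact Or.inl hz0
  · -- off the lid the tails have the same collapse
    have h1 : (1 - (z 0 : ℝ)) ≠ 0 := fun h' => hz0 (Subtype.ext (by rw [Set.Icc.coe_one]; linarith))
    have htail : collapse (Fin.tail z) = collapse (Fin.tail z') := by
      apply StdSimplex.ext_coe
      funext j
      have := congrFun hc j.succ
      simp only [Fin.cons_succ] at this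
      rw [← h0] at this
      exact mul_left_cancel₀ h1 this
    by_cases hb : Fin.tail z ∈ Cube.boundary (Fin n)
    · obtain ⟨j, hj⟩ := hb
      exact Or.inr ⟨j.succ, Fin.succ_ne_zero j, hj⟩
    · exfalso
      apply hne
      rw [← Fin.cons_self_tail z, ← Fin.cons_self_tail z', h0, eq_of_collapse_eq htail hb]

/-- A relative generalized loop (free face `{z₀ = 0}`) is constant on the fibres of the cone chart.
[folklore] -/
lemma factorsThrough_coneChart {A : Set X} {a : A} (q : RelGenLoop (0 : Fin (n + 1)) A a) :
    Function.FactorsThrough (q : C((Fin (n + 1) → I), X)) (coneChart n) := by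
  intro z z' h
  by_cases hzz : z = z'
  · rw [hzz]
  · show q z = q z'
    rw [RelGenLoop.apply_of_mem_jBoundary q (mem_jBoundary_of_coneChart_eq h hzz),
      RelGenLoop.apply_of_mem_jBoundary q (mem_jBoundary_of_coneChart_eq h.symm (Ne.symm hzz))]

/-- **A point of the `1`-skeleton of `Δᵏ⁺³` is the image of a point of `J` only**: off `J` the
cone chart has at least `k + 3 ≥ 3` non-zero coordinates. [folklore] -/
lemma mem_jBoundary_of_coneChart_mem_stdSkel_one {k : ℕ} {z : Fin (k + 3) → I}
    (hz : coneChart (k + 2) z ∈ stdSkel (k + 3) 1) : z ∈ RelGenLoop.jBoundary (0 : Fin (k + 3)) := by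
  by_contra hJ
  have hz0 : z 0 ≠ 1 := fun h => hJ (Or.inl h)
  have htail : Fin.tail z ∉ Cube.boundary (Fin (k + 2)) := by
    rintro ⟨j, hj⟩
    exact hJ (Or.inr ⟨j.succ, Fin.succ_ne_zero j, hj⟩)
  have hκ : ∀ j : Fin (k + 3), (collapse (Fin.tail z) : Fin (k + 3) → ℝ) j ≠ 0 := fun j hj =>
    collapse_not_mem_stdBoundary htail ⟨j, hj⟩
  have h1 : (1 - (z 0 : ℝ)) ≠ 0 := fun h' => hz0 (Subtype.ext (by rw [Set.Icc.coe_one]; linarith))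
  -- all the coordinates `j + 1` of the image are non-zero
  rw [mem_stdSkel_iff] at hz
  have hsub : Finset.univ.image Fin.succ ⊆ StdSimplex.nzCoords (coneChart (k + 2) z) := by
    intro i hi
    obtain ⟨j, -, rfl⟩ := Finset.mem_image.1 hi
    rw [StdSimplex.mem_nzCoords, coe_coneChart, Fin.cons_succ]
    exact mul_ne_zero h1 (hκ j)
  have := (Finset.card_le_card hsub)
  rw [Finset.card_image_of_injective _ (Fin.succ_injective _), Finset.card_univ, Fintype.card_fin] at this
  omega

end ConeChart

/-! ### The degeneracy `degenOne` is Mathlib's `stdSimplex.map (Fin.predAbove 1)` -/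

section Degen

variable {n : ℕ}

/-- `predAbove 1 i = 0 ↔ i = 0`. [folklore] -/
lemma predAbove_one_eq_zero_iff (i : Fin (n + 3)) : Fin.predAbove (1 : Fin (n + 2)) i = 0 ↔ i = 0 := by
  constructor
  · intro h
    by_contra hi
    have h1 : (1 : Fin (n + 3)) ≤ i := by
      rw [Fin.le_def, Fin.val_one]; exact Nat.one_le_iff_ne_zero.2 (fun h0 => hi (Fin.ext h0))
    have := Fin.predAbove_right_monotone (1 : Fin (n + 2)) h1
    rw [h, show Fin.predAbove (1 : Fin (n + 2)) 1 = 1 from by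
      rw [← Fin.castSucc_one, Fin.predAbove_castSucc_self]] at this
    exact absurd this (by simp)
  · rintro rfl; exact Fin.predAbove_right_zero

/-- `predAbove 1 i = 1 ↔ i ∈ {1, 2}`. [folklore] -/
lemma predAbove_one_eq_one_iff (i : Fin (n + 3)) : Fin.predAbove (1 : Fin (n + 2)) i = 1 ↔ i = 1 ∨ i = 2 := by
  constructor
  · intro h
    cases i using Fin.cases with
    | zero => rw [Fin.predAbove_right_zero] at h; exact absurd h (by simp)
    | succ j =>
      cases j using Fin.cases with
      | zero => left; rfl
      | succ l =>
        right
        rw [Fin.predAbove_succ_of_le _ _ (by rw [Fin.le_def, Fin.val_one, Fin.val_succ]; omega)] at h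
        rw [← Fin.succ_one_eq_two, h]
  · rintro (rfl | rfl)
    · rw [← Fin.castSucc_one, Fin.predAbove_castSucc_self]
    · rw [← Fin.succ_one_eq_two, Fin.predAbove_succ_self]

/-- `predAbove 1 i = l + 2 ↔ i = l + 3`. [folklore] -/
lemma predAbove_one_eq_succ_succ_iff (i : Fin (n + 3)) (l : Fin n) :
    Fin.predAbove (1 : Fin (n + 2)) i = l.succ.succ ↔ i = l.succ.succ.succ := by
  constructor
  · intro h
    cases i using Fin.cases with
    | zero => rw [Fin.predAbove_right_zero] at h; exact absurd (congrArg Fin.val h) (by simp)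
    | succ j =>
      cases j using Fin.cases with
      | zero =>
        rw [Fin.succ_zero_eq_one, ← Fin.castSucc_one, Fin.predAbove_castSucc_self] at h
        exact absurd (congrArg Fin.val h) (by simp)
      | succ l' =>
        rw [Fin.predAbove_succ_of_le _ _ (by rw [Fin.le_def, Fin.val_one, Fin.val_succ]; omega)] at h
        rw [h]
  · rintro rfl
    rw [Fin.predAbove_succ_of_le _ _ (by rw [Fin.le_def, Fin.val_one, Fin.val_succ, Fin.val_succ]; omega)]

/-- The coordinate `0` of `stdSimplex.map (predAbove 1) z` is `z₀`. [folklore] -/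
lemma map_predAbove_one_apply_zero (z : StdSimplex (n + 2)) :
    (stdSimplex.map (Fin.predAbove (1 : Fin (n + 2))) z : Fin (n + 2) → ℝ) 0 = (z : Fin (n + 3) → ℝ) 0 := by
  classical
  rw [stdSimplex.map_coe, FunOnFinite.linearMap_apply_apply]
  have : Finset.univ.filter (fun i : Fin (n + 3) => Fin.predAbove (1 : Fin (n + 2)) i = 0) = {0} := by
    ext i; simp [predAbove_one_eq_zero_iff]
  rw [this, Finset.sum_singleton]

/-- The coordinate `1` of `stdSimplex.map (predAbove 1) z` is `z₁ + z₂`. [folklore] -/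
lemma map_predAbove_one_apply_one (z : StdSimplex (n + 2)) :
    (stdSimplex.map (Fin.predAbove (1 : Fin (n + 2))) z : Fin (n + 2) → ℝ) 1 =
      (z : Fin (n + 3) → ℝ) 1 + (z : Fin (n + 3) → ℝ) 2 := by
  classical
  rw [stdSimplex.map_coe, FunOnFinite.linearMap_apply_apply]
  have : Finset.univ.filter (fun i : Fin (n + 3) => Fin.predAbove (1 : Fin (n + 2)) i = 1) = {1, 2} := by
    ext i; simp [predAbove_one_eq_one_iff]
  rw [this, Finset.sum_pair (show (1 : Fin (n + 3)) ≠ 2 from fun h => by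
    have := congrArg Fin.val h; rw [Fin.val_one, Fin.val_two] at this; omega)]

/-- The coordinates `l + 2` of `stdSimplex.map (predAbove 1) z` are `z_{l+3}`. [folklore] -/
lemma map_predAbove_one_apply_succ_succ (z : StdSimplex (n + 2)) (l : Fin n) :
    (stdSimplex.map (Fin.predAbove (1 : Fin (n + 2))) z : Fin (n + 2) → ℝ) l.succ.succ =
      (z : Fin (n + 3) → ℝ) l.succ.succ.succ := by
  classical
  rw [stdSimplex.map_coe, FunOnFinite.linearMap_apply_apply]
  have : Finset.univ.filter (fun i : Fin (n + 3) => Fin.predAbove (1 : Fin (n + 2)) i = l.succ.succ) =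
      {l.succ.succ.succ} := by
    ext i; simp [predAbove_one_eq_succ_succ_iff]
  rw [this, Finset.sum_singleton]

/-- **`degenOne` is Mathlib's degeneracy `stdSimplex.map (Fin.predAbove 1)`** (the claim of its
docstring in `RelativeHomotopyAdditionCone.lean`, proved coordinatewise). [folklore] -/
theorem degenOne_eq_map (z : StdSimplex (n + 2)) :
    degenOne n z = stdSimplex.map (Fin.predAbove (1 : Fin (n + 2))) z := by
  apply StdSimplex.ext_coe
  rw [coe_degenOne]
  funext i
  cases i using Fin.cases with
  | zero => rw [degenCoord_zero]; exact (map_predAbove_one_apply_zero z).symm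
  | succ j =>
    cases j using Fin.cases with
    | zero => rw [Fin.succ_zero_eq_one, degenCoord_one]; exact (map_predAbove_one_apply_one z).symm
    | succ l => rw [degenCoord_succ_succ]; exact (map_predAbove_one_apply_succ_succ z l).symm

end Degen

/-! ### Every class is a cone class of a simplex with the `1`-skeleton at `a` -/

section Surjective

variable {A : Set X} {a : A} {k : ℕ}

/-- The vertices lie in the `1`-skeleton. [folklore] -/
lemma vertex_mem_stdSkel_one {q : ℕ} (i : Fin (q + 1)) :
    stdSimplex.vertex (S := ℝ) i ∈ stdSkel q 1 :=
  stdSkel_mono q (Nat.zero_le 1) (vertex_mem_stdSkel_zero i)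

/-- **Every element of `π_{k+3}(X, A, a)` is the cone class of a map `(Δᵏ⁺³, ∂Δᵏ⁺³) → (X, A)` sending
the `1`-skeleton to `a`** (Spanier 1981, p. 393: "any element of `πₙ(X, A, x₀)` can be represented
by such a map `α`"): a representative descends along the cone chart, a quotient map on whose
non-trivial fibres (inside `J`) it is constant. [cite: Spanier1981, Ch. 7 §5 p. 393] -/
theorem exists_coneClass_eq (c : RelHomotopyGroup.Pi (k + 3) X A a) :
    ∃ (α : C(StdSimplex (k + 3), X)) (hA : ∀ t ∈ stdBoundary (k + 3), α t ∈ A)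
      (h1 : ∀ t ∈ stdSkel (k + 3) 1, α t = a),
      coneClass (m := k + 1) α ⟨hA, h1 _ (vertex_mem_stdSkel_one 0)⟩ = c := by
  induction c using Quotient.inductionOn with
  | h q =>
    set α : C(StdSimplex (k + 3), X) :=
      isQuotientMap_coneChart.lift (q : C((Fin (k + 3) → I), X)) (factorsThrough_coneChart q) with hαdef
    have hακ : α.comp (coneChart (k + 2)) = (q : C((Fin (k + 3) → I), X)) :=
      isQuotientMap_coneChart.lift_comp _ _
    have hαz : ∀ z, α (coneChart (k + 2) z) = q z := fun z =>
      congrFun (congrArg DFunLike.coe hακ) z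
    have hA : ∀ t ∈ stdBoundary (k + 3), α t ∈ A := by
      intro t ht
      obtain ⟨z, rfl⟩ := coneChart_surjective t
      have hz : z ∈ Cube.boundary (Fin (k + 3)) := by
        by_contra h'
        exact coneChart_not_mem_stdBoundary h' ht
      rw [hαz]
      exact RelGenLoop.apply_mem_of_mem_boundary q hz
    have h1 : ∀ t ∈ stdSkel (k + 3) 1, α t = a := by
      intro t ht
      obtain ⟨z, rfl⟩ := coneChart_surjective t
      rw [hαz]
      exact RelGenLoop.apply_of_mem_jBoundary q (mem_jBoundary_of_coneChart_mem_stdSkel_one ht)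
    refine ⟨α, hA, h1, ?_⟩
    rw [coneClass, ← lidClass_eq_mk q]
    exact lidClass_congr _ _ fun y => hαz y

end Surjective

/-! ### Spanier's `ψ` for cone classes -/

namespace ConeProof

variable (A : Set X) (a : A) (k : ℕ)

open Classical in
/-- **Spanier's `ψ` on a singular simplex** (1981, Ch. 7 §5 (d), p. 397: `ψ(σ) = [σ]'`), with the
cone class: `[σ] ∈ π_{k+3}(X, A, a)` (written additively) if `σ : Δᵏ⁺³ → X` is a map of triples
`(Δᵏ⁺³, ∂Δᵏ⁺³, v₀) → (X, A, a)`, and `0` otherwise. [cite: Spanier1981, Ch. 7 §5 p. 397] -/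
def psiGen (η : SingularSimplex X (k + 3)) : Additive (RelHomotopyGroup.Pi (k + 3) X A a) :=
  if h : SingularSimplex.toContinuousMap η ∈ RelSimplexMap (k + 2) A a then
    Additive.ofMul (coneClass (m := k + 1) (SingularSimplex.toContinuousMap η) h)
  else 0

/-- **Spanier's `ψ`** extended linearly to the integral chains. [cite: Spanier1981, Ch. 7 §5 p. 397] -/
def psi : CChain ℤ X (k + 3) →ₗ[ℤ] Additive (RelHomotopyGroup.Pi (k + 3) X A a) :=
  Finsupp.linearCombination ℤ (psiGen A a k)

variable {A a k}

/-- `ψ` on an elementary chain. [folklore] -/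
@[simp]
lemma psi_single (η : SingularSimplex X (k + 3)) (c : ℤ) :
    psi A a k (Finsupp.single η c) = c • psiGen A a k η :=
  Finsupp.linearCombination_single ℤ _ _

/-- `ψ(σ) = [σ]` for a map of triples. [folklore] -/
lemma psiGen_of_mem {η : SingularSimplex X (k + 3)}
    (h : SingularSimplex.toContinuousMap η ∈ RelSimplexMap (k + 2) A a) :
    psiGen A a k η = Additive.ofMul (coneClass (m := k + 1) (SingularSimplex.toContinuousMap η) h) :=
  dif_pos h

/-- `ψ` of the simplex of a map of triples `α` is `[α]`. [folklore] -/
lemma psiGen_ofMap {α : C(StdSimplex (k + 3), X)} (h : α ∈ RelSimplexMap (k + 2) A a) :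
    psiGen A a k (SingularSimplex.ofMap α) = Additive.ofMul (coneClass (m := k + 1) α h) := by
  have h' : SingularSimplex.toContinuousMap (SingularSimplex.ofMap α) ∈ RelSimplexMap (k + 2) A a := by
    rwa [SingularSimplex.toContinuousMap_ofMap]
  rw [psiGen_of_mem h']
  exact congrArg Additive.ofMul (coneClass_congr _ _ fun t => by rw [SingularSimplex.toContinuousMap_ofMap])

/-- A simplex of dimension `k + 3` with `(k+2)`-skeleton in `A` and `1`-skeleton at `a` is a map of
triples. [folklore] -/
lemma mem_relSimplexMap_of_isRelEilenberg₁ {η : SingularSimplex X (k + 3)}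
    (hη : IsRelEilenberg₁ A (a : X) (k + 2) η) :
    SingularSimplex.toContinuousMap η ∈ RelSimplexMap (k + 2) A a :=
  ⟨fun _ ht => hη.isRelEilenberg.apply_mem_of_mem_stdBoundary ht, hη.apply_vertex 0⟩

/-- **`ψ(σ) = 0` for a simplex of `A`** which is a map of triples (compression). [cite: Spanier1981, Ch. 7 §5 p. 397] -/
lemma psiGen_eq_zero_of_range_subset {η : SingularSimplex X (k + 3)}
    (h : SingularSimplex.toContinuousMap η ∈ RelSimplexMap (k + 2) A a) (hA : η.range ⊆ A) :
    psiGen A a k η = 0 := by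
  rw [psiGen_of_mem h, coneClass_eq_one_of_forall_mem h fun t => hA ⟨t, rfl⟩, ofMul_one]

/-- A point of `Δ^{p+3}` whose coordinates beyond the first two vanish lies in the `1`-skeleton.
[folklore] -/
lemma mem_stdSkel_one_of_edge {p : ℕ} {z : StdSimplex (p + 3)}
    (hz : ∀ l : Fin (p + 2), (z : Fin (p + 4) → ℝ) l.succ.succ = 0) : z ∈ stdSkel (p + 3) 1 := by
  rw [mem_stdSkel_iff]
  have hsub : StdSimplex.nzCoords z ⊆ {0, 1} := fun i hi => by
    rw [StdSimplex.mem_nzCoords] at hi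
    rw [Finset.mem_insert, Finset.mem_singleton]
    cases i using Fin.cases with
    | zero => exact Or.inl rfl
    | succ j =>
      cases j using Fin.cases with
      | zero => exact Or.inr rfl
      | succ l => exact absurd (hz l) hi
  exact (Finset.card_le_card hsub).trans (Finset.card_le_two)

/-- **`ψ ∘ ∂ = 0` on simplices with `(k+2)`-skeleton in `A` and `1`-skeleton at `a`** (Spanier 1981,
p. 397: "`ψ ∂(σ) = ∑ (-1)ⁱ [σ⁽ⁱ⁾]' = η σ_# j_# (bₙ) = 0`"), by the homotopy addition theorem for
cone classes (`sum_neg_one_pow_smul_coneClass_eq_zero`). [cite: Spanier1981, Ch. 7 §5 p. 397] -/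
lemma psi_bd_single_eq_zero (τ : SingularSimplex X (k + 4)) (hτ : IsRelEilenberg₁ A (a : X) (k + 2) τ)
    (c : ℤ) : psi A a k (csingularChainComplex.bd ℤ (k + 3) (Finsupp.single τ c)) = 0 := by
  rw [csingularChainComplex.bd_single, map_sum]
  have hv : ∀ i : Fin (k + 5), SingularSimplex.toContinuousMap τ (stdSimplex.vertex (S := ℝ) i) = a :=
    hτ.apply_vertex
  have he : EdgeToBase a (SingularSimplex.toContinuousMap τ) := fun z hz =>
    hτ.2 z (mem_stdSkel_one_of_edge hz)
  have key : ∀ i : Fin (k + 5), psi A a k (((-1 : ℤ) ^ (i : ℕ)) • Finsupp.single (τ.face i) c) =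
      c • (((-1 : ℤ) ^ (i : ℕ)) • Additive.ofMul (coneClass (m := k + 1) (a := a)
        ((SingularSimplex.toContinuousMap τ).comp (stdFace i))
          (comp_stdFace_mem_relSimplexMap (m := k + 2) _ hτ.1 hv i))) := by
    intro i
    have hmem : SingularSimplex.toContinuousMap (τ.face i) ∈ RelSimplexMap (k + 2) A a :=
      mem_relSimplexMap_of_isRelEilenberg₁ (hτ.face i)
    rw [map_smul, psi_single, psiGen_of_mem hmem, smul_comm]
    rfl
  simp_rw [key, ← Finset.smul_sum]
  rw [sum_neg_one_pow_smul_coneClass_eq_zero (SingularSimplex.toContinuousMap τ) hτ.1 hv he, smul_zero]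

/-- `ψ (∂ c) = 0` for a chain `c` of such simplices. [folklore] -/
lemma psi_bd_eq_zero (c : CChain ℤ X (k + 4)) (hc : ∀ τ ∈ c.support, IsRelEilenberg₁ A (a : X) (k + 2) τ) :
    psi A a k (csingularChainComplex.bd ℤ (k + 3) c) = 0 := by
  rw [← Finsupp.sum_single c, Finsupp.sum, map_sum, map_sum]
  exact Finset.sum_eq_zero fun τ hτ => psi_bd_single_eq_zero τ (hc τ hτ) _

/-- `ψ z = 0` for a chain `z` of `A` whose simplices are maps of triples. [folklore] -/
lemma psi_eq_zero_of_mem_chainsIn (z : CChain ℤ X (k + 3)) (hz : z ∈ chainsIn ℤ ℤ X A (k + 3))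
    (hz' : ∀ η ∈ z.support, SingularSimplex.toContinuousMap η ∈ RelSimplexMap (k + 2) A a) :
    psi A a k z = 0 := by
  rw [← Finsupp.sum_single z, Finsupp.sum, map_sum]
  refine Finset.sum_eq_zero fun η hη => ?_
  rw [psi_single, psiGen_eq_zero_of_range_subset (hz' η hη) ((mem_chainsIn_iff ℤ ℤ z).1 hz η hη), smul_zero]

end ConeProof

/-! ### The core of Spanier's (d): classes which bound are trivial -/

section Core

open ConeProof

variable {A : Set X} {a : A} {k : ℕ}

/-- The simplex of a map `(Δᵏ⁺³, ∂Δᵏ⁺³) → (X, A)` with `1`-skeleton at `a` lies in the subcomplex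
of level `k + 2`. [folklore] -/
lemma isRelEilenberg₁_ofMap {α : C(StdSimplex (k + 3), X)} (hA : ∀ t ∈ stdBoundary (k + 3), α t ∈ A)
    (h1 : ∀ t ∈ stdSkel (k + 3) 1, α t = a) :
    IsRelEilenberg₁ A (a : X) (k + 2) (SingularSimplex.ofMap α) := by
  refine ⟨fun t ht => ?_, fun t ht => ?_⟩
  · rw [SingularSimplex.toContinuousMap_ofMap]
    exact hA t (by rw [stdBoundary_eq_stdSkel]; exact ht)
  · rw [SingularSimplex.toContinuousMap_ofMap]
    exact h1 t ht

/-- **The core of Spanier's argument (d) for the pair `(X, A)`** (1981, Ch. 7 §5, p. 397), with cone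
classes and a retraction `ρ` onto the simplices with `(k+2)`-skeleton in `A` and `1`-skeleton at `a`:
if the elementary chain of a map `α : (Δᵏ⁺³, ∂Δᵏ⁺³) → (X, A)` with `1`-skeleton at `a` is a
relative boundary — `∂w - α ∈ Δ(A)` — then `[α] = 1` in `π_{k+3}(X, A, a)`: `α = ∂(ρ♯ w) - ρ♯ z`,
and `ψ` kills both terms. [cite: Spanier1981, Ch. 7 §5 p. 397] -/
theorem coneClass_eq_one_of_bd_sub_mem (E : RelEilenbergRetraction₁ X A (a : X) (k + 2))
    {α : C(StdSimplex (k + 3), X)} (hA : ∀ t ∈ stdBoundary (k + 3), α t ∈ A)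
    (h1 : ∀ t ∈ stdSkel (k + 3) 1, α t = a) (w : CChain ℤ X (k + 4))
    (hw : csingularChainComplex.bd ℤ (k + 3) w - Finsupp.single (SingularSimplex.ofMap α) 1 ∈
      chainsIn ℤ ℤ X A (k + 3)) :
    coneClass (m := k + 1) α ⟨hA, h1 _ (vertex_mem_stdSkel_one 0)⟩ = 1 := by
  set x : CChain ℤ X (k + 3) := Finsupp.single (SingularSimplex.ofMap α) 1 with hx
  have hαE : IsRelEilenberg₁ A (a : X) (k + 2) (SingularSimplex.ofMap α) := isRelEilenberg₁_ofMap hA h1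
  -- apply the retraction: `x = ∂ (ρ♯ w) - ρ♯ z`
  set z : CChain ℤ X (k + 3) := csingularChainComplex.bd ℤ (k + 3) w - x with hz
  have hρz : E.chainMap ℤ ℤ (k + 3) z = csingularChainComplex.bd ℤ (k + 3) (E.chainMap ℤ ℤ (k + 4) w) - x := by
    rw [hz, map_sub, E.bd_chainMap ℤ ℤ, hx, E.chainMap_single_of_isRelEilenberg₁ ℤ ℤ hαE]
  have hx_eq : x = csingularChainComplex.bd ℤ (k + 3) (E.chainMap ℤ ℤ (k + 4) w) - E.chainMap ℤ ℤ (k + 3) z := by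
    rw [hρz, sub_sub_cancel]
  -- apply `ψ`
  have e1 : psi A a k (csingularChainComplex.bd ℤ (k + 3) (E.chainMap ℤ ℤ (k + 4) w)) = 0 :=
    psi_bd_eq_zero _ fun τ hτ => E.isRelEilenberg₁_of_mem_support_chainMap ℤ ℤ w hτ
  have e2 : psi A a k (E.chainMap ℤ ℤ (k + 3) z) = 0 :=
    psi_eq_zero_of_mem_chainsIn _ (E.chainMap_mem_chainsIn ℤ ℤ hw) fun η hη =>
      mem_relSimplexMap_of_isRelEilenberg₁ (E.isRelEilenberg₁_of_mem_support_chainMap ℤ ℤ z hη)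
  have e3 : psi A a k x = Additive.ofMul (coneClass (m := k + 1) α ⟨hA, h1 _ (vertex_mem_stdSkel_one 0)⟩) := by
    rw [hx, psi_single, one_smul, psiGen_ofMap]
  have e4 : Additive.ofMul (coneClass (m := k + 1) α ⟨hA, h1 _ (vertex_mem_stdSkel_one 0)⟩) = 0 := by
    rw [← e3, hx_eq, map_sub, e1, e2, sub_zero]
  rwa [ofMul_eq_zero] at e4

/-- **With `H_{k+3}(X, A; ℤ) = 0`, every cone class `[α]` of a map `(Δᵏ⁺³, ∂Δᵏ⁺³) → (X, A)` with
`1`-skeleton at `a` is trivial** (given the retraction): the elementary chain of `α` is a relative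
cycle (its faces lie in `A`), hence a relative boundary (the homology hypothesis is moved to the
concrete quotient complex by `relativeSingularHomology.concreteIso`). [cite: Spanier1981, Ch. 7 §5 p. 397] -/
theorem coneClass_eq_one_of_isZero (E : RelEilenbergRetraction₁ X A (a : X) (k + 2))
    (hH : IsZero (relativeSingularHomology ℤ ℤ X A (k + 3)))
    {α : C(StdSimplex (k + 3), X)} (hA : ∀ t ∈ stdBoundary (k + 3), α t ∈ A)
    (h1 : ∀ t ∈ stdSkel (k + 3) 1, α t = a) :
    coneClass (m := k + 1) α ⟨hA, h1 _ (vertex_mem_stdSkel_one 0)⟩ = 1 := by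
  set K := csingularChainComplex ℤ ℤ X with hK
  set S : Subcomplex K := chainsInSub ℤ ℤ X A with hS
  set x : CChain ℤ X (k + 3) := Finsupp.single (SingularSimplex.ofMap α) 1 with hx
  -- `x` is a relative cycle: its faces lie in `A`
  have hfaces : csingularChainComplex.bd ℤ (k + 2) x ∈ chainsIn ℤ ℤ X A (k + 2) := by
    rw [hx, csingularChainComplex.bd_single]
    refine Submodule.sum_mem _ fun i _ => Submodule.smul_mem _ _ (single_mem_chainsIn ℤ ℤ ?_ 1)
    rintro _ ⟨t, rfl⟩
    rw [SingularSimplex.toContinuousMap_face_apply, SingularSimplex.toContinuousMap_ofMap]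
    exact hA _ (stdFace_mem_stdBoundary i t)
  have hnext : (ComplexShape.down ℕ).next (k + 3) = k + 2 := ChainComplex.next_nat_succ _
  have hcyc : K.d (k + 3) ((ComplexShape.down ℕ).next (k + 3)) x ∈ S ((ComplexShape.down ℕ).next (k + 3)) := by
    rw [hnext]
    change K.d (k + 3) (k + 2) x ∈ chainsIn ℤ ℤ X A (k + 2)
    rw [csingularChainComplex.d_apply]
    exact hfaces
  -- the homology of the concrete quotient vanishes, so `x` bounds modulo `C(A)`
  have hH' : IsZero (S.quotient.homology (k + 3)) :=
    hH.of_iso (relativeSingularHomology.concreteIso ℤ ℤ X A (k + 3)).symm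
  haveI := ModuleCat.subsingleton_of_isZero hH'
  have h0 : S.relCls x hcyc = 0 := Subsingleton.elim _ _
  rw [Subcomplex.relCls_eq_zero_iff] at h0
  have hprev : (ComplexShape.down ℕ).prev (k + 3) = k + 4 := ChainComplex.prev ℕ (k + 3)
  rw [hprev] at h0
  obtain ⟨w, hw⟩ := h0
  refine coneClass_eq_one_of_bd_sub_mem E hA h1 w ?_
  rw [← csingularChainComplex.d_apply]
  exact hw

/-- **`π_{k+3}(X, A, a) = 0`** given a relative Eilenberg retraction of level `k + 2` with normalised
`1`-skeleta and `H_{k+3}(X, A; ℤ) = 0` (Spanier 1981, Ch. 7 §5 (d) + Thm. 7.5.4, converse clause,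
degrees `≥ 3`; Miller 2020, Thm. 65.4): every element is the cone class of a map with `1`-skeleton at
`a` (`exists_coneClass_eq`), trivial by `coneClass_eq_one_of_isZero`. [cite: Spanier1981, Thm. 7.5.4] -/
theorem subsingleton_relHomotopyGroup_of_retraction₁ (E : RelEilenbergRetraction₁ X A (a : X) (k + 2))
    (hH : IsZero (relativeSingularHomology ℤ ℤ X A (k + 3))) :
    Subsingleton (RelHomotopyGroup.Pi (k + 3) X A a) := by
  refine ⟨fun c d => ?_⟩
  obtain ⟨α, hA, h1, rfl⟩ := exists_coneClass_eq c
  obtain ⟨β, hB, h1', rfl⟩ := exists_coneClass_eq d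
  rw [coneClass_eq_one_of_isZero E hH hA h1, coneClass_eq_one_of_isZero E hH hB h1']

end Core

/-! ### Miller's induction: the discharge -/

/-- **The vanishing form of the relative Hurewicz theorem** (Miller, *Lectures on Algebraic
Topology* (2020), Cor. 65.5, first clause; the named fact `relativeHurewicz_subsingleton` of
`RelativeHurewicz.lean`) HOLDS: for `X` and `↥A` simply connected, `n ≥ 2` and `Hᵢ(X, A; ℤ) = 0` for
`2 ≤ i < n`, the relative homotopy sets `π_k(X, A, a)` are trivial for all `1 ≤ k < n` and all `a`.
Miller's induction (p. 220): `k = 1` by exactness (`subsingleton_relHomotopyGroup_one`), `k = 2` by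
the degree-two step (`relativeHurewicz_pi_two_holds`, `RelativeHurewiczPiTwoProofs.lean`), and for
`k ≥ 3` the induction hypothesis makes `(X, A)` `(k-1)`-connected, so a relative Eilenberg retraction
of level `k - 1` with normalised `1`-skeleta exists (`exists_relEilenbergRetraction₁`, Spanier
Thm. 7.4.8) and `H_k(X, A; ℤ) = 0` kills `π_k(X, A, a)` by Spanier's (d) with the homotopy addition
theorem for cone classes (`subsingleton_relHomotopyGroup_of_retraction₁`). [cite: Miller2020, Cor. 65.5] -/
theorem relativeHurewicz_subsingleton_holds : relativeHurewicz_subsingleton.{u} := by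
  intro X _ A _ _ n _hn hH k
  induction k using Nat.strong_induction_on with
  | _ k ih =>
    intro _ hk a
    rcases (show k = 1 ∨ k = 2 ∨ 3 ≤ k by have := NeZero.one_le (n := k); omega) with rfl | rfl | h3
    · exact subsingleton_relHomotopyGroup_one_of_simplyConnectedSpace A a
    · exact relativeHurewicz_pi_two_holds X A (hH 2 le_rfl hk) a
    · obtain ⟨k, rfl⟩ : ∃ k', k = k' + 3 := ⟨k - 3, by omega⟩
      -- `(X, A)` is `(k+2)`-connected by the induction hypothesis
      have hconn : ∀ (q : ℕ) [NeZero q], q ≤ k + 2 → ∀ b : A, Subsingleton (RelHomotopyGroup.Pi q X A b) :=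
        fun q _ hq b => ih q (by omega) (by omega) b
      obtain ⟨E⟩ := exists_relEilenbergRetraction₁ A (k + 2) hconn a
      exact subsingleton_relHomotopyGroup_of_retraction₁ E (hH (k + 3) (by omega) hk)

end Literature.AlgebraicTopology.SingularHomology

end
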